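/-
Copyright (c) 2026 the pub-hodgecm-mathlib formalisation cell (harness21).  Prover seat hodgecm-mathlib-K2Liu-p27 (g0): Track B «K2-LIT»,
hLiu418 = stmt-HodgeConjecture-24832; LEAD F0P6-plan (g14) EMIT #1 2026-09-04T14:48:16Z, G6-fin (F2) ALL-`s₀` EDITION, file 1 (the `s₀`-threaded twins).
-/
import Summits.HodgeConjecture.HodgeConjecture.Theorems.K2LiuRankOneStage            -- ★ B7-S `exists_normalised_family` (+ ★ B7-N, ★ B3, ★ (a))
import Summits.HodgeConjecture.HodgeConjecture.Theorems.K2LiuA7NormaliserAlgebra      -- ★ B7-prep `isQRationalRegularAt_normalisedFactor` (at `½`)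
import HarnessLib

/-!
# Crux `HLiu418`, road `K2_Liu`, organ A7-reg (GK cocycle road), G6-fin (F2) ALL-`s₀` EDITION, file 1:
# THE `s₀`-THREADED TWINS — `L_F(2s+k)`, `b_n(s)`, the normalised factor, and one rank-one stage, regular at EVERY `s₀` (not only `½`)

Cell `hodgecm-mathlib`, crux item hLiu418 = `stmt-HodgeConjecture-24832`; squad K2 ∕ K2Liu; prover K2Liu-p27 (g0).  THEOREMS ONLY (no `def`,
no instance, no notation, no named-fact hypothesis, no `sorry`); lane `--supports stmt-HodgeConjecture-24832` (count-neutral helper).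
THE POINT (K2Liu-p09 (g7) σ21 2026-09-04T14:30:41Z; #41 consumer sheet G6-fin «normalised local operators contribute NO poles»).  ★ B7
`K2LiuA7NormalisedRegularity.normalisedRegularity` certifies `s ↦ Fn s h` regular AT `½` ONLY, because three of its inputs hard-code `s₀ = ½`:
★ (a) `isQRationalRegularAt_lF_two_mul_add_nat` ∕ `isQRationalRegularAt_bDen_half`, ★ B7-prep `isQRationalRegularAt_normalisedFactor`, and ★ B7-N ∕ B7-S
`isQRationalRegularAt_normalised_base` ∕ `exists_normalised_family`.  Mathematically `Fn = vol⁻¹ · b₂(s) · L_F(2s+1) · L_F(2s) · X(s)` with `X` built from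
flat point values and POLYNOMIALS in `q^{-s}`, so its only possible poles are those of `b₂ · L_F(2s+1) · L_F(2s)`, at `re s ∈ {0, −½, −1}`; hence `Fn` is
regular on ALL of `0 < re s`.  This file supplies the `s₀`-threaded twins; the sequels re-run ★ B7 (non-split), ★ B7s (split), ★ B7 (every place) and
★ B8-CM with the output `∀ s₀, 0 < re s₀ → ∀ h, IsQRationalRegularAt q_v s₀ (Fn · h)`.
* §1 `isQRationalRegularAt_lF_two_mul_add_nat_of_re_pos` (`0 < re s₀`), `isQRationalRegularAt_bDen_of_re` (`−½ < re s₀`, every rank `n`);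
* §2 `isQRationalRegularAt_normalisedFactor_of_re_pos` — `s ↦ vol⁻¹ · b₂(s) · lF(2s+1) · lF(2s) · X s` regular at `s₀` when `X` is and `0 < re s₀`;
* §3 `isQRationalRegularAt_normalised_base_at` — ★ B7-N at an arbitrary `s₀`;
* §4 `exists_normalised_family_allS0` — ★ B7-S with ONE explicit family `N` and the regularity clause quantified over every `s₀`:
  «`C₀` and all `s ↦ Φ_s(g)` regular at `s₀` ⟹ all `s ↦ N s g` regular at `s₀`» (the family `N` does not depend on `s₀`).
HONEST LABEL.  `HC_CM` is proved only modulo the 7 printed citations (2 remaining named inputs: hLiu418 = `stmt-HodgeConjecture-24832`,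
h413 = `stmt-HodgeConjecture-24833`) until rung 0 closes.

## References
* [KudlaSweet1997] S. Kudla, W. J. Sweet, *Degenerate principal series representations for U(n,n)*, Israel J. Math. 98 (1997), §1 (poles of `b_n`, the
  normalised operator is holomorphic).
* [HarrisKudlaSweet1996] M. Harris, S. Kudla, W. J. Sweet, J. AMS 9 (1996), §6 (6.14)–(6.16) (`a_n`, `b_n`).
* [Casselman1980] W. Casselman, *The unramified principal series of p-adic groups I*, Compositio Math. 40 (1980), §3 Thm. 3.1.
* [Tate1950] J. Tate, *Fourier analysis in number fields and Hecke's zeta-functions* (1950), §2.5 (local factors).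
-/

set_option autoImplicit false
set_option linter.dupNamespace false -- the mandated namespace repeats `HodgeConjecture.HodgeConjecture`

noncomputable section

open MeasureTheory
open scoped NNReal ENNReal
open NumberField IsDedekindDomain
open Literature.NumberTheory.GaloisRepresentations.IsNonarchimedeanLocalField
open Literature.NumberTheory.Automorphic Literature.NumberTheory.Automorphic.UnitaryGroup Literature.NumberTheory.Automorphic.LocalFieldHaar
open Summit.HodgeConjecture.HodgeConjecture.Cruxes.HLiu418.K2LiuQRationalDefs
open Summit.HodgeConjecture.HodgeConjecture.Cruxes.HLiu418.K2LiuQRationalLFactor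
open Summit.HodgeConjecture.HodgeConjecture.Cruxes.HLiu418.K2LiuLocalLFactorDefs
open Summit.HodgeConjecture.HodgeConjecture.Cruxes.HLiu418.K2LiuRankOneOperators
open Summit.HodgeConjecture.HodgeConjecture.Cruxes.HLiu418.K2LiuRankOneFamiliesBase
open Summit.HodgeConjecture.HodgeConjecture.Cruxes.HLiu418.K2LiuRankOneStage

namespace Summit.HodgeConjecture.HodgeConjecture.Cruxes.HLiu418.K2LiuA7NormalisedRegularityAllS0

/-! ## §1 `L_F(2s + k, χ_F)` and `b_n(s, χ_v)` at an arbitrary `s₀` -/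

section Quadratic

variable {F : Type} [Field F] [NumberField F] {E : Type} [Field E] [NumberField E] [Algebra F E]
  (c : E ≃ₐ[F] E) {v : HeightOneSpectrum (𝓞 F)} {χv : ∀ w : PlacesOver E v, (w.1.adicCompletion E)ˣ →* ℂˣ}

/-- **`s ↦ L_F(2s + k, χ_{F,v})` is regular at every `s₀` with `0 < re s₀`** (`k ∈ ℕ`, unitary `χ_v`; `re (2s₀ + k) = 2 re s₀ + k > 0`) — the
`s₀`-threaded twin of ★ (a) `isQRationalRegularAt_lF_two_mul_add_nat`. [cite: KudlaSweet1997, §1] [cite: Tate1950, §2.5] -/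
theorem isQRationalRegularAt_lF_two_mul_add_nat_of_re_pos
    (hχ : ∀ (w : PlacesOver E v) (x : (w.1.adicCompletion E)ˣ), ‖((χv w x : ℂˣ) : ℂ)‖ = 1) (k : ℕ) {s₀ : ℂ} (hs₀ : 0 < s₀.re) :
    IsQRationalRegularAt (residueFieldCard (v.adicCompletion F)) s₀ fun s => lF F E v χv (2 * s + k) := by
  have hk : (0 : ℝ) ≤ k := Nat.cast_nonneg k
  have h := isQRationalRegularAt_lF_affine (v := v) hχ 2 (k : ℂ) (s₀ := s₀)
    (by simp only [Nat.cast_ofNat, Complex.add_re, Complex.mul_re, Complex.re_ofNat, Complex.im_ofNat, Complex.natCast_re]; linarith)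
  simpa only [Nat.cast_ofNat] using h

variable (χv) in
/-- **`s ↦ b_n(s, χ_v) = Π_{j<n} L_F(2s + n − j, χ_F η^j)` is regular at every `s₀` with `−½ < re s₀`** for unitary `χ_v` (each argument has real part
`2 re s₀ + n − j ≥ 2 re s₀ + 1 > 0`) — the `s₀`-threaded twin of ★ (a) `isQRationalRegularAt_bDen_half`. [cite: KudlaSweet1997, §1] [cite: HarrisKudlaSweet1996, §6 (6.16)] -/
theorem isQRationalRegularAt_bDen_of_re
    (hχ : ∀ (w : PlacesOver E v) (x : (w.1.adicCompletion E)ˣ), ‖((χv w x : ℂˣ) : ℂ)‖ = 1) (n : ℕ) {s₀ : ℂ} (hs₀ : -(1 / 2 : ℝ) < s₀.re) :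
    IsQRationalRegularAt (residueFieldCard (v.adicCompletion F)) s₀ (bDen F E c v n χv) := by
  have h : IsQRationalRegularAt (residueFieldCard (v.adicCompletion F)) s₀
      fun s => ∏ j ∈ Finset.range n, gkFactor F E c v χv j ((2 : ℕ) * s + ((n : ℂ) - (j : ℂ))) := by
    refine IsQRationalRegularAt.prod _ fun j hj => isQRationalRegularAt_gkFactor_affine c hχ j 2 _ ?_
    have hjn : (j : ℝ) + 1 ≤ n := by exact_mod_cast Finset.mem_range.1 hj
    simp only [Nat.cast_ofNat, Complex.add_re, Complex.sub_re, Complex.mul_re, Complex.re_ofNat, Complex.im_ofNat, Complex.natCast_re]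
    linarith
  refine h.congr fun s => ?_
  simp only [bDen, Nat.cast_ofNat]
  refine Finset.prod_congr rfl fun j _ => ?_
  ring_nf

/-! ## §2 The normalised factor `vol⁻¹ · b₂(s) · lF(2s+1) · lF(2s) · X(s)` at an arbitrary `s₀`, `0 < re s₀` -/

variable (χv) in
/-- **`s ↦ vol⁻¹ · b₂(s) · lF(2s+1) · lF(2s) · X(s)` is regular at every `s₀` with `0 < re s₀`** when `X` is (unitary `χ_v`) — the `s₀`-threaded twin of
★ B7-prep `isQRationalRegularAt_normalisedFactor`: the normalised factor of A7-reg has no pole on `0 < re s`. [cite: KudlaSweet1997, §1] -/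
theorem isQRationalRegularAt_normalisedFactor_of_re_pos
    (hχ : ∀ (w : PlacesOver E v) (x : (w.1.adicCompletion E)ˣ), ‖((χv w x : ℂˣ) : ℂ)‖ = 1) (vol : ℝ) {s₀ : ℂ} (hs₀ : 0 < s₀.re)
    {X : ℂ → ℂ} (hX : IsQRationalRegularAt (residueFieldCard (v.adicCompletion F)) s₀ X) :
    IsQRationalRegularAt (residueFieldCard (v.adicCompletion F)) s₀ fun s =>
      (vol : ℂ)⁻¹ * bDen F E c v 2 χv s * lF F E v χv (2 * s + 1) * lF F E v χv (2 * s) * X s := by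
  have h1 := isQRationalRegularAt_lF_two_mul_add_nat_of_re_pos (v := v) hχ 1 hs₀
  have h0 := isQRationalRegularAt_lF_two_mul_add_nat_of_re_pos (v := v) hχ 0 hs₀
  simp only [Nat.cast_one, Nat.cast_zero, add_zero] at h1 h0
  exact ((((isQRationalRegularAt_bDen_of_re c χv hχ 2 (by linarith)).const_mul _).mul h1).mul h0).mul hX

end Quadratic

/-! ## §3 The normalised rank-one value at an arbitrary `s₀` (★ B7-N twin) -/

section RankOne

variable {K : Type} [Field K] [NumberField K] {w : HeightOneSpectrum (𝓞 K)} {G : Type*} [Group G]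

/-- **THE NORMALISED VALUE IS `q₀^{-s}`-RATIONAL AND REGULAR AT `s₀`, base `q₀` with `q_w = q₀^d`** — ★ B7-N `isQRationalRegularAt_normalised_base` verbatim with
`½` replaced by an arbitrary `s₀`: with `e(s) = a·s + c`, a character `ν`, and `s ↦ C₀(s)`, `s ↦ f_s(y)`, `s ↦ f_s(w u(b) y)` (`b ∈ R`) regular at `s₀` in `q₀^{-s}`,
the function `s ↦ (1 − unramValue ν q_w^{−(e(s)−1)}) Σ_{b∈R} μ(𝔭^m) f_s(w u(b) y) + C₀(s) f_s(y) (1 − q_w⁻¹) μ(𝒪) (unramValue ν q_w^{1−e(s)})^{m+1}` is regular at `s₀`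
in `q₀^{-s}`. [cite: KudlaSweet1997, §1] [cite: Casselman1980, §3] -/
theorem isQRationalRegularAt_normalised_base_at [MeasurableSpace (w.adicCompletion K)] (μ : Measure (w.adicCompletion K))
    (q₀ d : ℕ) (hq₀ : q₀ ≠ 0) (hq : residueFieldCard (w.adicCompletion K) = q₀ ^ d)
    (f : ℂ → G → ℂ) {u : w.adicCompletion K → G} (w₀ y : G)
    (ν : (w.adicCompletion K)ˣ →* ℂˣ) (a : ℕ) (c : ℂ) (C₀ : ℂ → ℂ) (m : ℕ) (R : Finset (w.adicCompletion K)) (s₀ : ℂ)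
    (hC₀ : IsQRationalRegularAt q₀ s₀ C₀)
    (hfy : IsQRationalRegularAt q₀ s₀ fun s => f s y)
    (hfR : ∀ b ∈ R, IsQRationalRegularAt q₀ s₀ fun s => f s (w₀ * u b * y)) :
    IsQRationalRegularAt q₀ s₀ fun s =>
      (1 - unramValue K w ν * (residueFieldCard (w.adicCompletion K) : ℂ) ^ (-(((a : ℂ) * s + c) - 1))) *
          (∑ b ∈ R, (μ.real (primePowBall (w.adicCompletion K) (m : ℤ)) : ℂ) * f s (w₀ * u b * y)) +
        C₀ s * f s y * (1 - (residueFieldCard (w.adicCompletion K) : ℂ)⁻¹) * μ.real (primePowBall (w.adicCompletion K) 0) *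
          (unramValue K w ν * (residueFieldCard (w.adicCompletion K) : ℂ) ^ (1 - ((a : ℂ) * s + c))) ^ (m + 1) := by
  set q : ℕ := residueFieldCard (w.adicCompletion K) with hqdef
  have hmono : IsQRationalRegularAt q₀ s₀ fun s => (q : ℂ) ^ (1 - ((a : ℂ) * s + c)) :=
    isQRationalRegularAt_monomial_base q₀ d hq₀ hq a c s₀
  have hmono' : IsQRationalRegularAt q₀ s₀ fun s => (q : ℂ) ^ (-(((a : ℂ) * s + c) - 1)) :=
    hmono.congr fun s => by show (q : ℂ) ^ (1 - ((a : ℂ) * s + c)) = _; congr 1; ring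
  have hhead : IsQRationalRegularAt q₀ s₀ fun s => ∑ b ∈ R, (μ.real (primePowBall (w.adicCompletion K) (m : ℤ)) : ℂ) * f s (w₀ * u b * y) :=
    IsQRationalRegularAt.sum R fun b hb => (hfR b hb).const_mul _
  have h1 : IsQRationalRegularAt q₀ s₀ fun s => 1 - unramValue K w ν * (q : ℂ) ^ (-(((a : ℂ) * s + c) - 1)) :=
    (isQRationalRegularAt_const q₀ _ 1).sub (hmono'.const_mul _)
  have h2 : IsQRationalRegularAt q₀ s₀ fun s => (unramValue K w ν * (q : ℂ) ^ (1 - ((a : ℂ) * s + c))) ^ (m + 1) := by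
    have h := hmono.const_mul (unramValue K w ν)
    exact IsQRationalRegularAt.prod (Finset.range (m + 1)) (Φ := fun _ s => unramValue K w ν * (q : ℂ) ^ (1 - ((a : ℂ) * s + c)))
      (fun _ _ => h) |>.congr fun s => by simp [Finset.prod_const, Finset.card_range]
  exact (h1.mul hhead).add ((((hC₀.mul hfy).mul (isQRationalRegularAt_const q₀ _ _)).mul (isQRationalRegularAt_const q₀ _ _)).mul h2)

/-! ## §4 One rank-one stage of the cocycle, the family regular at EVERY `s₀` (★ B7-S twin) -/

variable [TopologicalSpace G] [IsTopologicalGroup G]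
  [MeasurableSpace (w.adicCompletion K)] [BorelSpace (w.adicCompletion K)] (μ : Measure (w.adicCompletion K)) [μ.IsAddHaarMeasure]

/-- **ONE STAGE OF THE COCYCLE IN BOTH CURRENCIES, ALL `s₀`.**  Let `Φ : ℂ → G → ℂ` be a family which on the half-plane `1 < re s` is right-`K′`-invariant and
satisfies the `SL₂` relation with datum `(C₀(s), ν, e(s) = a s + c)` (`ν` unitary, `re e(s) > 1` there).  Then there is ONE explicit family `N : ℂ → G → ℂ`
(★ B3's normalised value at the per-point data of ★ B7-S §1, chosen independently of `s`) such that
(i) for EVERY `s₀ : ℂ`: if `C₀` and all `s ↦ Φ_s(g)` are `q₀^{-s}`-rational and regular at `s₀` (`q_w = q₀^d`), then so is every `s ↦ N s g`;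
(ii) on `1 < re s`: `x ↦ Φ_s(w₀ u(x) g)` is integrable and **`∫ Φ_s(w₀ u(x) g) dμ(x) = L(e(s) − 1, ν) · N s g`**.
The `s₀`-threaded twin of ★ B7-S `exists_normalised_family` (which is clause (i) at `s₀ = ½` only). [cite: Casselman1980, §3 Thm. 3.1] [cite: KudlaSweet1997, §1] -/
theorem exists_normalised_family_allS0 (Φ : ℂ → G → ℂ) {K' : Subgroup G} (hK' : IsOpen (K' : Set G))
    (hΦK : ∀ s : ℂ, 1 < s.re → ∀ g, ∀ k ∈ K', Φ s (g * k) = Φ s g)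
    {u ū : w.adicCompletion K → G} (hu : Continuous u) (hu0 : u 0 = 1) (hū : Continuous ū) (hū0 : ū 0 = 1) (hu_add : ∀ x t, u (x + t) = u x * u t) (w₀ : G)
    (ν : (w.adicCompletion K)ˣ →* ℂˣ) (hν : ∀ x, ‖((ν x : ℂˣ) : ℂ)‖ = 1) (a : ℕ) (c : ℂ) (he : ∀ s : ℂ, 1 < s.re → 1 < ((a : ℂ) * s + c).re)
    (C₀ : ℂ → ℂ) (q₀ d : ℕ) (hq₀ : q₀ ≠ 0) (hq : residueFieldCard (w.adicCompletion K) = q₀ ^ d)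
    (hrel : ∀ s : ℂ, 1 < s.re → ∀ (x : (w.adicCompletion K)ˣ) (g : G),
      Φ s (w₀ * u x * g) = C₀ s * (((ν x)⁻¹ : ℂˣ) : ℂ) * ((normAbs (w.adicCompletion K) (x : w.adicCompletion K) : ℝ) : ℂ) ^ (-((a : ℂ) * s + c)) *
        Φ s (ū ((x⁻¹ : (w.adicCompletion K)ˣ) : w.adicCompletion K) * g)) :
    ∃ N : ℂ → G → ℂ,
      (∀ s₀ : ℂ, IsQRationalRegularAt q₀ s₀ C₀ → (∀ g, IsQRationalRegularAt q₀ s₀ fun s => Φ s g) →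
        ∀ g, IsQRationalRegularAt q₀ s₀ fun s => N s g) ∧
      ∀ s : ℂ, 1 < s.re → ∀ g,
        Integrable (fun x => Φ s (w₀ * u x * g)) μ ∧
          ∫ x, Φ s (w₀ * u x * g) ∂μ = lFactor K w ν ((a : ℂ) * s + c - 1) * N s g := by
  -- the per-point data, chosen once (independently of `s` and of `s₀`)
  choose m R hmu hmū hRinc hRcov using fun g => exists_level_and_reps hu hu0 hū hū0 K' hK' g
  refine ⟨fun s g =>
      (1 - unramValue K w ν * (residueFieldCard (w.adicCompletion K) : ℂ) ^ (-(((a : ℂ) * s + c) - 1))) *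
          (∑ b ∈ R g, (μ.real (primePowBall (w.adicCompletion K) (m g : ℤ)) : ℂ) * Φ s (w₀ * u b * g)) +
        C₀ s * Φ s g * (1 - (residueFieldCard (w.adicCompletion K) : ℂ)⁻¹) * μ.real (primePowBall (w.adicCompletion K) 0) *
          (unramValue K w ν * (residueFieldCard (w.adicCompletion K) : ℂ) ^ (1 - ((a : ℂ) * s + c))) ^ (m g + 1),
    fun s₀ hC₀ hreg g => isQRationalRegularAt_normalised_base_at μ q₀ d hq₀ hq Φ w₀ g ν a c C₀ (m g) (R g) s₀ hC₀ (hreg g) fun b _ => hreg _,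
    fun s hs g => ?_⟩
  exact ⟨(integrable_and_integral_eq μ (hΦK s hs) hu_add w₀ ν hν _ (C₀ s) (he s hs) (hrel s hs) g (m g) (hmu g) (hmū g) (R g) (hRinc g) (hRcov g)).1,
    integral_eq_lFactor_mul_normalised μ (hΦK s hs) hu_add w₀ ν hν _ (C₀ s) (he s hs) (hrel s hs) g (m g) (hmu g) (hmū g) (R g) (hRinc g) (hRcov g)⟩

end RankOne

end Summit.HodgeConjecture.HodgeConjecture.Cruxes.HLiu418.K2LiuA7NormalisedRegularityAllS0

end
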